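import Summits.NavierStokesRegularity.NavierStokesRegularity.Theorems.ExtremiserTransienceNearExtremalTransiencePerFlowStubZoomPackageFlow
import Summits.NavierStokesRegularity.NavierStokesRegularity.Theorems.ExtremiserTransienceNearExtremalTransiencePerFlowStubGrowthTransferFlow
import Summits.NavierStokesRegularity.NavierStokesRegularity.Theorems.ExtremiserTransienceNearExtremalTransiencePerFlowStubFlowFilamentBudget
import Summits.NavierStokesRegularity.NavierStokesRegularity.Theorems.ExtremiserTransienceMemberSelection
import HarnessLib

/-!
# Route `ExtremiserTransience`, crux `NearExtremalTransiencePerFlow` (stmt-NavierStokesRegularity-26567) —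
# LINE g9-β «filament selection» §3b: the crux from T1 `CoherentSelection` and the heart H′ `NoFilamentTubeSliceAllTime`, BY NAME

`--supports stmt-NavierStokesRegularity-26567`.  Prover seat ns-net-p2 (g6).  With F1 (`FilamentGap.flowFilamentBudget`), T2′
(`FilamentSelection.zoomPackageFlow`) and G′ (`FilamentSelection.growthTransferFlow`) landed, the all-time composition §3b of the crux
workfile `Cruxes/NearExtremalTransiencePerFlow/Lines/filament_selection.lean` becomes a theorem of the tree with only the two genuinely
open pieces as hypotheses:

  `nearExtremalTransiencePerFlow_of_coherentSelection_of_noFilamentTubeSliceAllTime :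
     CoherentSelection → NoFilamentTubeSliceAllTime → NearExtremalTransiencePerFlow`

(`CoherentSelection` = δ's T1 by name, text of record `…Theorems.NearExtremalTransiencePerFlow.MemberSelection.CoherentSelection`;
`NoFilamentTubeSliceAllTime` written out verbatim with `HasLinGrowth` unfolded and `IsTubeSlice` by name — the crux workfile is not
importable).  Violator frame by contradiction → F1 budget `A` → T0 data (theorem `efficientTimesNoDust_holds`) → T2′ zoom family + flow-level
compactness with the Type-I pinning → T1 selection → the selected limit is the slice `W s` of a Type-I ancient mild field whose EVERY
slice has linear local-energy growth with the constant `A` (G′) → extremal branch closed by the landed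
`not_isExtremalSlice_of_typeIAncientMild` (extended sharp inequality + interior contact + one-slice plateau rigidity), tube branch = H′.
HONEST FRAMING: a conditional reduction; `CoherentSelection` (δ-T1) and `NoFilamentTubeSliceAllTime` (the heart H′, whose periodic
sub-cases are the landed rungs R1/R2) remain OPEN; nothing about Navier–Stokes regularity or blow-up is proved; no summit is proved by
a line. [folklore]
-/

noncomputable section

open scoped Topology InnerProductSpace RealInnerProductSpace ENNReal ContDiff
open MeasureTheory Filter Set Metric Function
open Literature.Analysis Literature.Analysis.FluidPDE
open Summit.NavierStokesRegularity.NavierStokesRegularity.Theses.ExtremiserTransience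
open Summit.NavierStokesRegularity.NavierStokesRegularity.Theorems.NearExtremalTransiencePerFlow.ZoneTransversality
open Summit.NavierStokesRegularity.NavierStokesRegularity.Theorems.NearExtremalTransiencePerFlow.MemberSelection

namespace Summit.NavierStokesRegularity.NavierStokesRegularity.Theorems

set_option linter.dupNamespace false

namespace NearExtremalTransiencePerFlow.FilamentSelection

/-- **The crux `NearExtremalTransiencePerFlow` (26567) from δ-T1 `CoherentSelection` and the all-time heart H′ `NoFilamentTubeSliceAllTime`,
by name** (the all-time composition §3b of LINE g9-β with F1, T2′, G′ discharged by the landed `flowFilamentBudget`, `zoomPackageFlow`,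
`growthTransferFlow`).  H′ is written out: no slice `W s` (`s < 0`) of a Type-I ancient mild field ALL of whose slices have linear
local-energy growth `∫_{B(x,R)}‖W τ‖² ≤ A R` (one constant `A`, every `τ < 0`) is a tube slice. [folklore] -/
theorem nearExtremalTransiencePerFlow_of_coherentSelection_of_noFilamentTubeSliceAllTime
    (hT1 : CoherentSelection)
    (hH : ∀ (K A : ℝ) (W : ℝ → EuclideanSpace ℝ (Fin 3) → EuclideanSpace ℝ (Fin 3)) (s : ℝ),
      Literature.Analysis.FluidPDE.IsTypeIAncientMild K W → s < 0 →
      (∀ τ : ℝ, τ < 0 → ∀ (x : EuclideanSpace ℝ (Fin 3)) (R : ℝ), 0 < R →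
        ∫ z in Metric.ball x R, ‖W τ z‖ ^ 2 ≤ A * R) →
      ¬ IsTubeSlice (W s)) :
    NearExtremalTransiencePerFlow := by
  have hT0 : EfficientTimesNoDust := efficientTimesNoDust_holds
  intro C ν T hC hν hT u p hsol hLH hdec hrate hsing
  by_contra hno
  have hV : IsViolator C ν T u p := ⟨hC, hν, hT, hsol, hLH, hdec, hrate, hsing, hno⟩
  -- F1: the filament budget of the flow (landed)
  obtain ⟨A, hA⟩ := FilamentGap.flowFilamentBudget C ν T hC hν hT u p hsol hLH hdec hrate
  -- T0: near-efficient late times with a Taylor bound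
  obtain ⟨Θ, t, Mb, ε, hdata⟩ := hT0 C ν T u p hV
  -- T2′: zoom family and flow-level compactness (landed)
  obtain ⟨σ, Λ, Θ', ε', hσ, hfam, hcompF⟩ := zoomPackageFlow C ν T u p hV Θ t Mb ε hdata
  -- T1: coherent selection
  obtain ⟨y, φ, W₀, hφ, hconv, hdich⟩ := hT1 _ Λ Θ' ε' hfam
  obtain ⟨ψ, K, s, W, hψ, hW, hs, hpin, hconvF⟩ := hcompF y φ hφ
  -- the slice family is the instance `τ = s` of the flow-level convergence
  have hconv' : ∀ z : EuclideanSpace ℝ (Fin 3), Tendsto (fun n => (Mb (σ (φ (ψ n))))⁻¹ •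
      u (t (σ (φ (ψ n)))) ((ν / Mb (σ (φ (ψ n)))) • (y (φ (ψ n)) + z))) atTop (𝓝 (W s z)) := by
    intro z
    have h1 := hconvF s hs z
    simpa only [sub_self, mul_zero, add_zero] using h1
  have hWs : W s = W₀ :=
    funext fun z => tendsto_nhds_unique (hconv' z) ((hconv z).comp hψ.tendsto_atTop)
  subst hWs
  -- G′ at every rescaled time (landed)
  have htT : Tendsto (fun n => t (σ (φ (ψ n)))) atTop (𝓝 T) :=
    hdata.2.1.comp ((hσ.comp (hφ.comp hψ)).tendsto_atTop)
  have hgrowthAll : ∀ τ : ℝ, τ < 0 → ∀ (x : EuclideanSpace ℝ (Fin 3)) (R : ℝ), 0 < R →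
      ∫ z in Metric.ball x R, ‖W τ z‖ ^ 2 ≤ A * R := by
    intro τ hτ
    exact growthTransferFlow ν A T u (fun n => t (σ (φ (ψ n)))) (fun n => Mb (σ (φ (ψ n)))) (fun n => y (φ (ψ n))) s τ (W τ)
      hν hT (fun n => hdata.2.2.2.1 _) (fun n => (hdata.1 _).2) htT
      (fun t' ht' => (hsol.contDiff_velocity ht').continuous) hA hs hpin hτ (hconvF τ hτ)
  rcases hdich with hext | htube
  · -- extremal branch: closed unconditionally (landed)
    exact not_isExtremalSlice_of_typeIAncientMild hW hs hext
  · -- tube branch: excluded by H′ with growth at ALL times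
    exact hH K A W s hW hs hgrowthAll htube

end NearExtremalTransiencePerFlow.FilamentSelection

end Summit.NavierStokesRegularity.NavierStokesRegularity.Theorems

end
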